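import Summits.QuantumFields.YangMills.Theorems.LuscherReductionTwistedTraceScalingOnionRefinedScales
import Summits.QuantumFields.YangMills.Theorems.LuscherReductionTwistedTraceScalingToronZPELipschitz
import HarnessLib

/-!
# The C3 VALLEY SKELETON, kernel-checked: `ValleyKernelRowBoundAt` (hence COARSE-UPPER(L)) from TWO named sub-targets — the Born–Oppenheimer pointwise bound with the
# matching k = 0 floor (`ValleyBOAt`), and the valley geometry (`ValleyGeomAt`) — via the toron gain and the Lipschitz zero-point sum
# (lane A of S-BASE, crux `TwistedTraceScaling` stmt-QuantumFields-20203; design note `pub/ym-fleet/ym-luscher-20007-p1/COARSE-DESIGN.md` §15–§16)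

With the refined onion (`…OnionRefined*`: the valley may sit at `η = β^{−q}`, `q < 8/9`) the VALLEY stub C3 reduces to the covariant row bound
`ValleyKernelRowBoundAt L δ η` (`…ValleySchurDoor`).  This file closes it MODULO two precisely typed statements, by a proof that is already complete:
* `zpeSum L κ U = Σ_{i<3|E|} modeZPE(κ·σᵢ(D_U)²)` — the frame-free ZERO-POINT SUM of the covariant curl at `U` (singular values; `…ToronZPELipschitz`);
* ★ `ValleyBOAt L δ η` — the SEMICLASSICAL CORE (lane B's covariant super-solution chain + the shared k = 0 trial bound, SAME normalisation `N`): for some `κ > 0`,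
  `C ≥ 0` and every `ε > 0`, eventually in `β`, a number `N > 0` with `λ₀(β,L) ≥ N·e^{−6·toronZPE L κ 0 0}·e^{−Cλ_b(L³β)}` and a measurable weight `h`,
  `0 ≤ h ≤ C_h`, `h ≥ c > 0` on the valley set, with the POINTWISE bound `(K_β h)(U) ≤ N·e^{ελ_b(L³β)}·e^{−zpeSum L κ U}·h(U)` at every valley point;
* ★ `ValleyGeomAt L δ η` — the GEOMETRY (C3c-LOW; `…ToronCoercive` holds its local half): for some `c₀ > 0` and every `ε > 0`, eventually in `β`, every valley point
  `U` admits a gauge `g`, angles `θ` and a direction `k` with `‖D_U v − D_{g·V_θ} v‖ ≤ ε·δ(β)·‖v‖` for all `v` and `c₀·δ(β) ≤ ‖(2θ_k : AddCircle(2π/L))‖`;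
* ★★★ `valleyKernelRowBoundAt_of_bo_geom : ValleyBOAt L δ η → ValleyGeomAt L δ η → (∀ M, eventually M·λ_b(L³β) ≤ δ β) → ValleyKernelRowBoundAt L δ η` —
  proof: at a valley point, `zpeSum ≥ 6Z(0) + 4·gain1Slope·‖2θ_k‖ − 3|E|√(κ/2)·εδ` (`sum_modeZPE_ge_vacuum_add_gain_of_near` + `Frame.IsDiag.sum_modeZPE_eq_sum_singularValues`),
  choose `ε` so the Lipschitz loss is half the gain, then `2·gain1Slope·c₀·δ ≥ (A + C + 1)λ_b` eventually;
* `powScale_dominates_bareLambda : p < 1/3 → ∀ M, eventually M·λ_b(L³β) ≤ β^{−p}`, and the END-TO-END corollary ★★★ `coarseNoIntruderAt_of_bo_geom_pow :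
  0 < p < 1/3 → q < 8/9 → ValleyBOAt L (β^{−p}) (β^{−q}) → ValleyGeomAt L (β^{−p}) (β^{−q}) → InnerNoIntruderOneOrbitAt L (β^{−p}) → ⟨VERBATIM body of CoarseNoIntruderAt L⟩`.
Consistent exponents (§16): `(p, q) = (1/16, 0.85)` — `q > 4p`, `q − p > 2/3`, `q > 1/2 + 2p`, `q < 8/9`.
HONEST FRAMING: the two sub-targets are OPEN (BO: L/XL, lane B's chain at `σ = 2β^{−q}` + C3d; GEOM: L, Łojasiewicz + slice); this file is their kernel-checked
composition; femto rung R2b1 of the CONDITIONAL reduction route; not infinite volume, not a gap, not Clay.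
-/

set_option autoImplicit false

noncomputable section

open MeasureTheory Filter Topology Real Module
open scoped BigOperators InnerProductSpace
open Literature.MathematicalPhysics.QuantumFieldTheory
open Literature.MathematicalPhysics.QuantumLattice

namespace Summit.QuantumFields.YangMills.Theorems.FemtoTransferGap

open TwoLattice TwoLattice.Toron TwoLattice.Cov TwoLattice.Stiff

variable (L : ℕ) [NeZero L]

/-! ## §1 The frame-free zero-point sum and the two sub-targets -/

/-- **The zero-point sum of the covariant curl at `U`**: `Σ_{i < 3|E|} modeZPE(κ·σᵢ(D_U)²)` over the singular values of `D_U = covCurl U` (frame-free; every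
orthonormal frame diagonalising `‖D_U·‖²` computes it, `Frame.IsDiag.sum_modeZPE_eq_sum_singularValues`). [cite: Luscher1983, §3] -/
def zpeSum (κ : ℝ) (U : GaugeConfig 3 L SU2) : ℝ :=
  ∑ i : Fin (Fintype.card (Edge 3 L) * 3), modeZPE (κ * (covCurl U).singularValues i ^ 2)

/-- Every orthonormal frame diagonalising `‖D_U·‖²` computes `zpeSum`. [cite: HornJohnson2013, Thm 2.5.4] -/
theorem sum_modeZPE_eq_zpeSum {ι : Type*} [Fintype ι] [DecidableEq ι] {U : GaugeConfig 3 L SU2} {e : OrthonormalBasis ι ℝ (LinkSpace L)} {a : ι → ℝ}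
    (h : Frame.IsDiag (covCurl U) e a) (κ : ℝ) : ∑ i, modeZPE (κ * a i) = zpeSum L κ U :=
  h.sum_modeZPE_eq_sum_singularValues (finrank_linkSpace L) κ

/-- **Sub-target BO — the semiclassical core of the VALLEY** (OPEN; lane B's covariant super-solution chain at action scale `η` + the k = 0 trial bound with the SAME
normalisation): `∃ κ > 0, C ≥ 0, ∀ ε > 0`, eventually in `β`, `∃ N > 0` with `N·e^{−6·toronZPE L κ 0 0}·e^{−Cλ_b(L³β)} ≤ λ₀(β,L)`, and a measurable weight `h` with
`0 ≤ h ≤ C_h`, `h ≥ c > 0` on the valley set, such that `(K_β h)(U) ≤ N·e^{ελ_b(L³β)}·e^{−zpeSum L κ U}·h(U)` at every point of the valley set.  Target text of this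
programme (Lüscher 1983 §3, Wipf 2021 §8.5), not a published theorem. -/
def ValleyBOAt (δ η : ℝ → ℝ) : Prop :=
  ∃ κ : ℝ, 0 < κ ∧ ∃ C : ℝ, 0 ≤ C ∧ ∀ ε : ℝ, 0 < ε → ∃ β0 : ℝ, ∀ β : ℝ, β0 ≤ β →
    ∃ N : ℝ, 0 < N ∧
      N * Real.exp (-(6 * toronZPE L κ 0 0)) * Real.exp (-(C * bareLambda ((L : ℝ) ^ 3 * β))) ≤ levelValue su2Rep L β 0 ∧
      ∃ (h : GaugeConfig 3 L SU2 → ℝ) (c Ch : ℝ), Measurable h ∧ 0 < c ∧ (∀ U, 0 ≤ h U) ∧ (∀ U, h U ≤ Ch) ∧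
        (∀ U ∈ valleySet L (δ β) (η β), c ≤ h U) ∧
        ∀ U ∈ valleySet L (δ β) (η β),
          transferApply β h U ≤ N * Real.exp (ε * bareLambda ((L : ℝ) ^ 3 * β)) * Real.exp (-zpeSum L κ U) * h U

/-- **Sub-target GEOM — the valley geometry** (OPEN; C3c-LOW: Łojasiewicz to the flat family + coercivity `…ToronCoercive` + slice): `∃ c₀ > 0, ∀ ε > 0`, eventually in
`β`, every point `U` of the valley set admits a gauge `g`, angles `θ` and a direction `k` with `‖D_U v − D_{g·V_θ} v‖ ≤ ε·δ(β)·‖v‖` for all `v` and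
`c₀·δ(β) ≤ ‖(2θ_k : AddCircle(2π/L))‖`.  Target text of this programme (Lüscher 1983 §2–§3), not a published theorem. -/
def ValleyGeomAt (δ η : ℝ → ℝ) : Prop :=
  ∃ c₀ : ℝ, 0 < c₀ ∧ ∀ ε : ℝ, 0 < ε → ∃ β0 : ℝ, ∀ β : ℝ, β0 ≤ β →
    ∀ U ∈ valleySet L (δ β) (η β), ∃ (g : Site 3 L → SU2) (θ : Fin 3 → ℝ) (k : Fin 3),
      (∀ v, ‖covCurl U v - covCurl (gaugeTransform g (abelianCfg L θ)) v‖ ≤ ε * δ β * ‖v‖) ∧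
      c₀ * δ β ≤ ‖((2 * θ k : ℝ) : AddCircle (2 * Real.pi / L))‖

variable {L}

/-! ## §2 The composition -/

/-- ★★★ **THE C3 SKELETON**: `ValleyBOAt L δ η → ValleyGeomAt L δ η → (∀ M, eventually M·λ_b(L³β) ≤ δ β) → ValleyKernelRowBoundAt L δ η`.
[cite: Luscher1983, §3] [cite: LuscherMunster1984, §2] -/
theorem valleyKernelRowBoundAt_of_bo_geom {δ η : ℝ → ℝ} (hBO : ValleyBOAt L δ η) (hG : ValleyGeomAt L δ η) (hδ0 : ∀ β, 0 < δ β)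
    (hδ : ∀ M : ℝ, ∃ β0 : ℝ, ∀ β : ℝ, β0 ≤ β → M * bareLambda ((L : ℝ) ^ 3 * β) ≤ δ β) :
    ValleyKernelRowBoundAt L δ η := by
  intro A
  obtain ⟨κ, hκ, C, hC, hbo⟩ := hBO
  obtain ⟨c₀, hc₀, hgeom⟩ := hG
  -- constants
  set n : ℕ := Fintype.card (Edge 3 L) * 3 with hn
  set gS : ℝ := gain1Slope L κ with hgS
  have hgS0 : 0 < gS := gain1Slope_pos L hκ
  -- the geometry tolerance: Lipschitz loss ≤ half the gain, `n√(κ/2)·εG = 2 gS c₀`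
  set εG : ℝ := 2 * gS * c₀ / ((n : ℝ) * Real.sqrt (κ / 2) + 1) with hεG
  have hden : 0 < (n : ℝ) * Real.sqrt (κ / 2) + 1 := by positivity
  have hεG0 : 0 < εG := by rw [hεG]; positivity
  have hεGle : (n : ℝ) * (Real.sqrt (κ / 2) * εG) ≤ 2 * gS * c₀ := by
    rw [hεG]
    have : (n : ℝ) * (Real.sqrt (κ / 2) * (2 * gS * c₀ / ((n : ℝ) * Real.sqrt (κ / 2) + 1))) =
        ((n : ℝ) * Real.sqrt (κ / 2)) / ((n : ℝ) * Real.sqrt (κ / 2) + 1) * (2 * gS * c₀) := by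
      field_simp
    rw [this]
    have hfrac : ((n : ℝ) * Real.sqrt (κ / 2)) / ((n : ℝ) * Real.sqrt (κ / 2) + 1) ≤ 1 := by
      rw [div_le_one hden]; linarith
    have h2 : 0 ≤ 2 * gS * c₀ := by positivity
    exact mul_le_of_le_one_left h2 hfrac
  obtain ⟨βB, hB⟩ := hbo 1 one_pos
  obtain ⟨βG, hGe⟩ := hgeom εG hεG0
  obtain ⟨βM, hM⟩ := hδ ((A + C + 1) / (2 * gS * c₀))
  refine ⟨max βB (max βG βM), fun β hβ => ?_⟩
  have hβB : βB ≤ β := (le_max_left _ _).trans hβ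
  have hβG : βG ≤ β := ((le_max_left _ _).trans (le_max_right _ _)).trans hβ
  have hβM : βM ≤ β := ((le_max_right _ _).trans (le_max_right _ _)).trans hβ
  obtain ⟨N, hN, hfloor, h, c, Ch, hhm, hc, hh0, hhC, hhc, hrow⟩ := hB β hβB
  refine ⟨h, c, Ch, hhm, hc, hh0, hhc, hhC, fun U hU => ?_⟩
  have hhC' : ∀ V, |h V| ≤ Ch := fun V => by rw [abs_of_nonneg (hh0 V)]; exact hhC V
  refine (integral_indicator_kernel_le_transferApply (measurableSet_valleySet (δ β) (η β)) hhm hh0 hhC' U).trans ?_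
  refine (hrow U hU).trans ?_
  -- the zero-point sum at `U`: vacuum + gain − Lipschitz loss
  obtain ⟨g, θ, k, hnear, hfar⟩ := hGe β hβG U hU
  classical
  have hdiag := Frame.isDiag_eigenvectorBasis (covCurl U) (finrank_linkSpace L)
  have hδβ : 0 ≤ δ β := (hδ0 β).le
  have hδpos : 0 ≤ εG * δ β := mul_nonneg hεG0.le hδβ
  have hzpe := sum_modeZPE_ge_vacuum_add_gain_of_near L g θ hdiag hκ hδpos hnear k
  rw [sum_modeZPE_eq_zpeSum L hdiag κ] at hzpe
  -- `zpeSum ≥ 6Z(0) + 4 gS c₀ δ − 2 gS c₀ δ`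
  have hloss : ((Fintype.card (Edge 3 L) * 3 : ℕ) : ℝ) * (Real.sqrt (κ / 2) * (εG * δ β)) ≤ 2 * gS * c₀ * δ β := by
    have := mul_le_mul_of_nonneg_right hεGle hδβ
    have e : ((Fintype.card (Edge 3 L) * 3 : ℕ) : ℝ) * (Real.sqrt (κ / 2) * (εG * δ β)) = (n : ℝ) * (Real.sqrt (κ / 2) * εG) * δ β := by
      rw [hn]; ring
    rw [e]; exact this
  have hgain : 4 * (gS * (c₀ * δ β)) ≤ 4 * (gS * ‖((2 * θ k : ℝ) : AddCircle (2 * Real.pi / L))‖) :=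
    mul_le_mul_of_nonneg_left (mul_le_mul_of_nonneg_left hfar hgS0.le) (by norm_num)
  have hz : 6 * toronZPE L κ 0 0 + 2 * gS * c₀ * δ β ≤ zpeSum L κ U := by rw [hgS] at hgain hloss ⊢; linarith
  -- the scale condition: `2 gS c₀ δ ≥ (A + C + 1) λ_b`
  have hscale : (A + C + 1) * bareLambda ((L : ℝ) ^ 3 * β) ≤ 2 * gS * c₀ * δ β := by
    have h := hM β hβM
    have h2 : 0 < 2 * gS * c₀ := by positivity
    rw [div_mul_eq_mul_div, div_le_iff₀ h2] at h
    linarith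
  -- assemble: `N e^{λ_b} e^{−zpe} ≤ e^{−Aλ_b} λ₀`
  set lam : ℝ := bareLambda ((L : ℝ) ^ 3 * β) with hlam
  set Z : ℝ := toronZPE L κ 0 0 with hZ
  have hl0 : 0 ≤ levelValue su2Rep L β 0 := le_trans (by positivity) hfloor
  have hE1 : Real.exp ((A + C + 1) * lam - 2 * gS * c₀ * δ β) ≤ 1 := by rw [Real.exp_le_one_iff]; linarith
  have hexp : Real.exp (1 * lam) * Real.exp (-(6 * Z + 2 * gS * c₀ * δ β)) =
      Real.exp (-(6 * Z)) * Real.exp (-(C * lam)) * (Real.exp (-(A * lam)) * Real.exp ((A + C + 1) * lam - 2 * gS * c₀ * δ β)) := by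
    simp only [← Real.exp_add]; congr 1; ring
  have key : N * Real.exp (1 * lam) * Real.exp (-zpeSum L κ U) ≤ Real.exp (-(A * lam)) * levelValue su2Rep L β 0 := by
    calc N * Real.exp (1 * lam) * Real.exp (-zpeSum L κ U)
        ≤ N * Real.exp (1 * lam) * Real.exp (-(6 * Z + 2 * gS * c₀ * δ β)) :=
          mul_le_mul_of_nonneg_left (Real.exp_le_exp.mpr (by linarith)) (by positivity)
      _ = (N * Real.exp (-(6 * Z)) * Real.exp (-(C * lam))) * (Real.exp (-(A * lam)) * Real.exp ((A + C + 1) * lam - 2 * gS * c₀ * δ β)) := by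
          rw [mul_assoc N, hexp]; ring
      _ ≤ levelValue su2Rep L β 0 * (Real.exp (-(A * lam)) * 1) :=
          mul_le_mul hfloor (mul_le_mul_of_nonneg_left hE1 (Real.exp_pos _).le) (by positivity) hl0
      _ = Real.exp (-(A * lam)) * levelValue su2Rep L β 0 := by ring
  exact mul_le_mul_of_nonneg_right key (hh0 U)

/-! ## §3 Polynomial scales and the end-to-end corollary -/

/-- For `p < 1/3` the inner radius `β^{−p}` dominates every multiple of `λ_b(L³β) ≍ β^{−1/3}`: `∀ M`, eventually `M·λ_b(L³β) ≤ β^{−p}`. [folklore] -/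
theorem powScale_dominates_bareLambda {p : ℝ} (hp : p < 1 / 3) (M : ℝ) :
    ∃ β0 : ℝ, ∀ β : ℝ, β0 ≤ β → M * bareLambda ((L : ℝ) ^ 3 * β) ≤ powScale p β := by
  have hL : (0 : ℝ) < (L : ℝ) ^ 3 := by
    have : (0 : ℝ) < L := by exact_mod_cast Nat.pos_of_ne_zero (NeZero.ne L)
    positivity
  by_cases hM : M ≤ 0
  · refine ⟨1, fun β hβ => ?_⟩
    have hβ0 : 0 < β := by linarith
    have h1 : 0 < bareLambda ((L : ℝ) ^ 3 * β) := bareLambda_pos' (by positivity)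
    have h2 := powScale_pos p β
    nlinarith
  · push Not at hM
    set K : ℝ := M * (2 / (L : ℝ) ^ 3) ^ ((1 : ℝ) / 3) with hK
    have hK0 : 0 < K := by rw [hK]; positivity
    have hq : 0 < 1 / 3 - p := by linarith
    obtain ⟨β0, h⟩ := rpow_neg_eventually_le hq (M := 1 / K) (by positivity)
    refine ⟨β0, fun β hβ => ?_⟩
    obtain ⟨hβ1, hle⟩ := h β hβ
    have hβ0 : 0 < β := by linarith
    rw [bareLambda_cube_eq (L := L) hβ0, powScale_eq hβ1]
    have hsplit : β ^ (-(1 : ℝ) / 3) = β ^ (-(1 / 3 - p)) * β ^ (-p) := by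
      rw [← Real.rpow_add hβ0]; congr 1; ring
    rw [hsplit]
    have hbp : 0 < β ^ (-p) := Real.rpow_pos_of_pos hβ0 _
    calc M * ((2 / (L : ℝ) ^ 3) ^ ((1 : ℝ) / 3) * (β ^ (-(1 / 3 - p)) * β ^ (-p)))
        = K * β ^ (-(1 / 3 - p)) * β ^ (-p) := by rw [hK]; ring
      _ ≤ K * (1 / K) * β ^ (-p) := by
          refine mul_le_mul_of_nonneg_right (mul_le_mul_of_nonneg_left hle hK0.le) hbp.le
      _ = β ^ (-p) := by field_simp

/-- ★★★ **END TO END: COARSE-UPPER(L) from the two VALLEY sub-targets and the INNER NO-INTRUDER (one orbit) at polynomial scales** `(δ, η) = (β^{−p}, β^{−q})`,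
`0 < p < 1/3`, `q < 8/9` (conclusion = VERBATIM the body of KTR's `CoarseNoIntruderAt L`; `L = 2` is stub 3b′). [cite: Luscher1983, §3] [cite: LuscherMunster1984, §2] -/
theorem coarseNoIntruderAt_of_bo_geom_pow {p q : ℝ} (hp0 : 0 < p) (hp : p < 1 / 3) (hq : q < 8 / 9)
    (hBO : ValleyBOAt L (powScale p) (powScale q)) (hG : ValleyGeomAt L (powScale p) (powScale q)) (hI : InnerNoIntruderOneOrbitAt L (powScale p)) :
    ∀ k : ℕ, ∀ d : ℝ, d < levelGap k → ∃ lam0 : ℝ, 0 < lam0 ∧ ∀ lam : ℝ, 0 < lam → lam ≤ lam0 →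
      ∀ β : ℝ, InFemtoWindow lam β L →
        levelValue su2Rep L β k ≤ Real.exp (-(d * luscherLambda β L) / L) * levelValue su2Rep L β 0 :=
  coarseNoIntruderAt_of_kernelRow_pow₉ hp0 hp hq
    (valleyKernelRowBoundAt_of_bo_geom hBO hG (fun β => powScale_pos p β) (powScale_dominates_bareLambda hp)) hI

end Summit.QuantumFields.YangMills.Theorems.FemtoTransferGap

end
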